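import Mathlib
import HarnessLib
import Literature.Computability.AlgebraicComplexity.PermanentIrreducible
import Summits.ValiantsHypothesis.ValiantsHypothesis.Theorems.MonotoneRestorationMonotoneRestorationQPBlockProjection

/-!
# ValiantsHypothesis / MonotoneRestoration — `MonotoneRestorationQP`, line `Sketch`, stub B5

Support file for crux item `stmt-ValiantsHypothesis-15886`
(`Summit.ValiantsHypothesis.ValiantsHypothesis.Theses.MonotoneRestoration.MonotoneRestorationQP`),
line `Sketch`, stub `stub_biMultilinear_shape` (Theorem β, B5): the monomial bookkeeping of the
bi-multilinear slice.

* (a) **Shape.** An exponent vector `d` on `Fin k × Fin k` with all row counts and column counts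
  `≤ 1` and degree `k` is a permutation monomial `permMonomial π`: `deg d = Σ_j colCount d j`
  forces every column count to be exactly `1`; the row `g j` of the unique variable in column `j`
  is injective in `j` (two columns sharing a row would give a row count `≥ 2`), hence bijective on
  `Fin k`, and `permMonomial (Equiv.ofBijective g _) = d` entrywise.
* (b) **Transport.** Along the block embedding `ι p = (Fin.castLE hkn p.1, Fin.castLE hkn p.2)`
  (injective: `MonotoneBlockProjection.blockEmb_injective` of the sibling stub file
  `MonotoneRestorationMonotoneRestorationQPBlockProjection`) the degree
  (`Finsupp.degree_mapDomain`), the row counts and the column counts (`Fintype.sum_of_injective`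
  over `Fin.castLE hkn`, with `Finsupp.mapDomain_apply` on the range and
  `Finsupp.mapDomain_notin_range` off it) are preserved.
* (c) **Degree bound.** `deg d = Σ_i rowCount d i ≤ Σ_i 1 = n` when all row counts are `≤ 1`.

No new definitions.
-/

-- `Summit.ValiantsHypothesis.ValiantsHypothesis.…` is the tree's mandated single-conjunct layout
-- (Sub = Summit), so the duplicated namespace component is intended.
set_option linter.dupNamespace false

noncomputable section

namespace Summit.ValiantsHypothesis.ValiantsHypothesis.Theorems

open Literature.Computability.AlgebraicComplexity MvPolynomial

/-! ### Degree as a sum of row / column counts -/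

/-- The degree of an exponent vector on `Fin n × Fin n` is the sum of its column counts.
[folklore] -/
theorem biMultilinearShape_degree_eq_sum_colCount {n : ℕ} (d : Fin n × Fin n →₀ ℕ) :
    d.degree = ∑ j, colCount d j := by
  unfold colCount
  rw [Finsupp.degree_eq_sum, Fintype.sum_prod_type, Finset.sum_comm]

/-- The degree of an exponent vector on `Fin n × Fin n` is the sum of its row counts.
[folklore] -/
theorem biMultilinearShape_degree_eq_sum_rowCount {n : ℕ} (d : Fin n × Fin n →₀ ℕ) :
    d.degree = ∑ i, rowCount d i := by
  unfold rowCount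
  rw [Finsupp.degree_eq_sum, Fintype.sum_prod_type]

/-! ### (a) Shape: unit margins of full degree are permutation monomials -/

/-- **(a) Shape.** An exponent vector on `Fin k × Fin k` all of whose row and column counts are
`≤ 1` and whose degree is `k` is a permutation monomial `permMonomial π`. [folklore] -/
theorem biMultilinearShape_exists_permMonomial_eq (k : ℕ) (d : Fin k × Fin k →₀ ℕ)
    (hrow : ∀ i, rowCount d i ≤ 1) (hcol : ∀ j, colCount d j ≤ 1) (hdeg : d.degree = k) :
    ∃ π : Equiv.Perm (Fin k), permMonomial π = d := by
  -- adapted from `ForgivenCollisions.exists_permMonomial_eq_of_counts_le_one` (same tree)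
  -- every column count is exactly one
  have hcol1 : ∀ j, colCount d j = 1 := by
    intro j
    by_contra hj
    have hlt : colCount d j < 1 := lt_of_le_of_ne (hcol j) hj
    have h' : ∑ j, colCount d j < ∑ _j : Fin k, (1 : ℕ) :=
      Finset.sum_lt_sum (fun j _ => hcol j) ⟨j, Finset.mem_univ _, hlt⟩
    rw [← biMultilinearShape_degree_eq_sum_colCount, hdeg] at h'
    simp at h'
  -- the row of the unique variable in each column
  have hex : ∀ j, ∃ r, d (r, j) ≠ 0 := fun j => by
    by_contra h
    have h0 : colCount d j = 0 :=
      Finset.sum_eq_zero fun r _ => not_not.mp (not_exists.mp h r)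
    rw [hcol1] at h0
    exact one_ne_zero h0
  choose g hg using hex
  have hg_inj : Function.Injective g := by
    intro j j' hjj'
    by_contra hne
    have h2 : d (g j, j) + d (g j, j') ≤ rowCount d (g j) := by
      unfold rowCount
      exact Finset.add_le_sum (f := fun c => d (g j, c)) (fun _ _ => Nat.zero_le _)
        (Finset.mem_univ _) (Finset.mem_univ _) hne
    have h1 : 1 ≤ d (g j, j) := Nat.one_le_iff_ne_zero.mpr (hg j)
    have h1' : 1 ≤ d (g j, j') := by
      rw [hjj']
      exact Nat.one_le_iff_ne_zero.mpr (hg j')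
    have := hrow (g j)
    omega
  refine ⟨Equiv.ofBijective g (Finite.injective_iff_bijective.mp hg_inj), ?_⟩
  ext ⟨r, c⟩
  rw [permMonomial_apply, Equiv.ofBijective_apply]
  have hle : d (g c, c) ≤ 1 :=
    (Finset.single_le_sum (f := fun r' => d (r', c)) (fun _ _ => Nat.zero_le _)
      (Finset.mem_univ (g c))).trans (hcol c)
  split_ifs with h
  · subst h
    have := hg c
    omega
  · by_contra hrc
    have h2 : d (g c, c) + d (r, c) ≤ colCount d c := by
      unfold colCount
      exact Finset.add_le_sum (f := fun r' => d (r', c)) (fun _ _ => Nat.zero_le _)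
        (Finset.mem_univ _) (Finset.mem_univ _) h
    have h1 : 1 ≤ d (g c, c) := Nat.one_le_iff_ne_zero.mpr (hg c)
    have := hcol c
    omega

/-! ### (b) Transport along the block embedding -/

/-- Values of the transported exponent on the block: `(ι_* d) (ι p) = d p`. [folklore] -/
theorem biMultilinearShape_mapDomain_apply_blockEmb {n k : ℕ} (hkn : k ≤ n)
    (d : Fin k × Fin k →₀ ℕ) (i j : Fin k) :
    Finsupp.mapDomain (fun p : Fin k × Fin k => (Fin.castLE hkn p.1, Fin.castLE hkn p.2)) d
        (Fin.castLE hkn i, Fin.castLE hkn j) = d (i, j) :=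
  Finsupp.mapDomain_apply (MonotoneBlockProjection.blockEmb_injective hkn) d (i, j)

/-- Values of the transported exponent off the block (column outside the range) vanish.
[folklore] -/
theorem biMultilinearShape_mapDomain_apply_of_col_notin {n k : ℕ} (hkn : k ≤ n)
    (d : Fin k × Fin k →₀ ℕ) (r c : Fin n) (hc : c ∉ Set.range (Fin.castLE hkn)) :
    Finsupp.mapDomain (fun p : Fin k × Fin k => (Fin.castLE hkn p.1, Fin.castLE hkn p.2)) d
        (r, c) = 0 := by
  refine Finsupp.mapDomain_notin_range _ _ ?_
  rintro ⟨p, hp⟩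
  exact hc ⟨p.2, (Prod.mk.inj hp).2⟩

/-- Values of the transported exponent off the block (row outside the range) vanish.
[folklore] -/
theorem biMultilinearShape_mapDomain_apply_of_row_notin {n k : ℕ} (hkn : k ≤ n)
    (d : Fin k × Fin k →₀ ℕ) (r c : Fin n) (hr : r ∉ Set.range (Fin.castLE hkn)) :
    Finsupp.mapDomain (fun p : Fin k × Fin k => (Fin.castLE hkn p.1, Fin.castLE hkn p.2)) d
        (r, c) = 0 := by
  refine Finsupp.mapDomain_notin_range _ _ ?_
  rintro ⟨p, hp⟩
  exact hr ⟨p.1, (Prod.mk.inj hp).1⟩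

/-- **(b) Transport.** Degree, row counts and column counts are preserved by the block
embedding `p ↦ (Fin.castLE hkn p.1, Fin.castLE hkn p.2)`. [folklore] -/
theorem biMultilinearShape_transport (n k : ℕ) (hkn : k ≤ n) (d : Fin k × Fin k →₀ ℕ) :
    (Finsupp.mapDomain (fun p : Fin k × Fin k => (Fin.castLE hkn p.1, Fin.castLE hkn p.2)) d).degree
        = d.degree ∧
    (∀ i, rowCount (Finsupp.mapDomain
        (fun p : Fin k × Fin k => (Fin.castLE hkn p.1, Fin.castLE hkn p.2)) d) (Fin.castLE hkn i)
          = rowCount d i) ∧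
    (∀ j, colCount (Finsupp.mapDomain
        (fun p : Fin k × Fin k => (Fin.castLE hkn p.1, Fin.castLE hkn p.2)) d) (Fin.castLE hkn j)
          = colCount d j) := by
  refine ⟨Finsupp.degree_mapDomain _ d, fun i => ?_, fun j => ?_⟩
  · unfold rowCount
    exact (Fintype.sum_of_injective (Fin.castLE hkn) (Fin.castLE_injective hkn)
      (fun c => d (i, c)) _
      (fun c hc => biMultilinearShape_mapDomain_apply_of_col_notin hkn d _ c hc)
      (fun c => (biMultilinearShape_mapDomain_apply_blockEmb hkn d i c).symm)).symm
  · unfold colCount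
    exact (Fintype.sum_of_injective (Fin.castLE hkn) (Fin.castLE_injective hkn)
      (fun r => d (r, j)) _
      (fun r hr => biMultilinearShape_mapDomain_apply_of_row_notin hkn d r _ hr)
      (fun r => (biMultilinearShape_mapDomain_apply_blockEmb hkn d r j).symm)).symm

/-! ### (c) Degree bound -/

/-- **(c) Degree bound.** An exponent vector on `Fin n × Fin n` all of whose row counts are `≤ 1`
has degree `≤ n`. [folklore] -/
theorem biMultilinearShape_degree_le (n : ℕ) (d : Fin n × Fin n →₀ ℕ)
    (hrow : ∀ i, rowCount d i ≤ 1) : d.degree ≤ n :=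
  calc d.degree = ∑ i, rowCount d i := biMultilinearShape_degree_eq_sum_rowCount d
    _ ≤ ∑ _i : Fin n, 1 := Finset.sum_le_sum fun i _ => hrow i
    _ = n := by simp

/-! ### The stub -/

/-- **B5 — shape of bi-multilinear monomials.** (a) A monomial on `Fin k × Fin k` using every row
and every column at most once and of degree `k` is a permutation monomial; (b) row counts, column
counts and degree are transported by the block embedding; (c) a bi-multilinear monomial on
`Fin n × Fin n` has degree `≤ n`. [folklore] -/
theorem stub_biMultilinear_shape :
    (∀ (k : ℕ) (d : Fin k × Fin k →₀ ℕ), (∀ i, rowCount d i ≤ 1) → (∀ j, colCount d j ≤ 1) →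
      d.degree = k → ∃ π : Equiv.Perm (Fin k), permMonomial π = d) ∧
    (∀ (n k : ℕ) (hkn : k ≤ n) (d : Fin k × Fin k →₀ ℕ),
      (Finsupp.mapDomain (fun p : Fin k × Fin k => (Fin.castLE hkn p.1, Fin.castLE hkn p.2)) d).degree
          = d.degree ∧
      (∀ i, rowCount (Finsupp.mapDomain
          (fun p : Fin k × Fin k => (Fin.castLE hkn p.1, Fin.castLE hkn p.2)) d) (Fin.castLE hkn i)
            = rowCount d i) ∧
      (∀ j, colCount (Finsupp.mapDomain
          (fun p : Fin k × Fin k => (Fin.castLE hkn p.1, Fin.castLE hkn p.2)) d) (Fin.castLE hkn j)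
            = colCount d j)) ∧
    (∀ (n : ℕ) (d : Fin n × Fin n →₀ ℕ), (∀ i, rowCount d i ≤ 1) → d.degree ≤ n) :=
  ⟨biMultilinearShape_exists_permMonomial_eq, biMultilinearShape_transport,
    biMultilinearShape_degree_le⟩

end Summit.ValiantsHypothesis.ValiantsHypothesis.Theorems
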